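import Summits.BirchSwinnertonDyer.BirchSwinnertonDyer.Theorems.ByReductionTypeAtTwoGoodOrdTowerCoinvCocycle
import HarnessLib

/-!
# Route `ByReductionTypeAtTwo`, item `OrdKatoHalfAtTwo` (stmt-BirchSwinnertonDyer-19271), TOWER road, the
# GOOD-ORDINARY local constant at `v ∣ 2`: KERNEL BRICK ε1 — the inflated cocycle of a `p`-torsion coinvariant class
# of the FULL fixed module `E(K̄_v)^{H_∞}` (class not necessarily in the formal group), with its parity profile

HONEST FRAMING (cell `bsd-2adic`, run/shared/lean/pub/bsd-2adic/, seat `bsd-2adic-tower-1` GEN 18, HUMAN RULINGS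
D-0036 / D-0054 / D-0074; wake item «IMC-LKε kernelisation», planner RC-201, HOME/plan/WAKE-IDLE-2ADIC-IMC-LKeps-kernelisation.md):
TOOL theorem only (no definition, no named fact, no `sorry`); closes nothing by itself; nothing booked; BSD is not proved by
any of this. First brick of the ε-REFINEMENT of the GEN 11 kernel theorem
`GoodOrdTower.pTorsion_localTowerKer_at_two_le_four_kernel` (`#𝒦_{v,n}[2^∞][2] ≤ 4` at a good ordinary `2`) to
`≤ 2` under `Δ_min ≡ ±3 (mod 8)` (cell `bsd-f1-sign2`'s typed statement IMC-LKε⁻≤,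
`F1Sign2.LocalKernelOneBitOffNormAtTwoLe`, MEMO-imc §10.45). Setting of BRICK G2 (`…GoodOrdTowerCoinvCocycle.lean`):
`p` any prime, `κ` the cyclotomic `ℤ_p`-extension of `ℚ`, `v ∋ p`, `K = ℚ_v`, `Γ = Gal(K̄/K)`, `H_m = localSubgroup (κ.layerSubgroup m) K`,
`H_∞ = localSubgroup κ.kerSubgroup K`, `E(K̄_v) = localPoints W K`, `g ∈ H_n` a topological generator of `H_n` modulo `H_∞`.

* **`exists_contOneCocycles_inflate_of_pow_smul`** — BRICK G2 (`exists_contOneCocycles_inflate`) asked the class `[x]`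
  to lie in a `Γ`-stable subgroup `A₁` whose `p`-torsion is `Γ`-fixed (the formal group); here `x ∈ E(K̄_v)^{H_∞}` is
  ARBITRARY and the hypothesis is replaced by «`p`-th powers act trivially on `E(K̄_v)[p]`» (`(σ^p) • a = a` whenever
  `p • a = 0`; at `p = 2` and a good ordinary `2` the image of `Γ` in `Aut E[2] ≅ S₃` stabilises the rational formal point,
  so has exponent `2`). For `x, y` fixed by `H_∞` with `p x = g y − y` there is a continuous `1`-cocycle `c` of `H_n` with
  values in `E(K̄_v)`, vanishing on `H_∞`, with `c(g) = x`, `p c(σ) = σ y − y`, and — the PARITY PROFILE — `r (c σ) = 0`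
  for every `σ ∈ H_{n+1}` and every additive map `r` invariant under `g` (the reduction map when `g` is inertial): on the
  coset `g^i H_{n+R}` the cocycle is the geometric sum `S_i(x) = Σ_{j<i} g^j x`, so `r(c σ) = i · r x`, and `σ ∈ H_{n+1}`
  iff `p ∣ i`, while `p · r x = r(g y − y) = 0`. Construction as in BRICK G2 (finite level `n + R₀` fixing `x, y`, now with
  `R₀ ≥ 1`, so that the norm element `S_{p^{R₀}}(x) ∈ E[p]` is fixed by `g^{p^{R₀}} = (g^{p^{R₀−1}})^p`).

References: R. Greenberg, LNM 1716 (1999), §3 Lemma 3.1 (p. 86), Lemma 3.4 (p. 89); J.-P. Serre, *Local Fields*, XIII §1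
Prop. 1; scope memos HOME/tower/SCOPE-hS34-layer-kernel-at-2-GEN7.md §1 and pub/bsd-f1-sign2/MEMO-imc-data/SCOPE-IMC-LKeps-kernel-g5.md.
-/

set_option autoImplicit false
-- the Theorems namespace of this sub repeats the summit name by design (D-0017 nested layout: Summit.<S>.<Sub>)
set_option linter.dupNamespace false

noncomputable section

open scoped Classical

universe u

namespace Summit.BirchSwinnertonDyer.BirchSwinnertonDyer.Theorems.GoodOrdTower

open NumberField IsDedekindDomain Field PadicInt Literature.NumberTheory.EllipticCurves
  Literature.NumberTheory.GaloisRepresentations WeierstrassCurve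

variable {p : ℕ} [Fact p.Prime] {κ : ZpExtension ℚ p}

/-- **The inflated cocycle of a `p`-torsion coinvariant class of the full fixed module, with its parity profile.** Let
`g ∈ H_n` be a topological generator of `H_n` modulo `H_∞` (the binder shape of BRICK 11
`MultTowerNS2.finite_torsionBy_localTowerKerPrimary_and_card_le`), suppose the `p`-th power of every `σ ∈ Γ` fixes every
`p`-torsion point of `E(K̄_v)`, and let `x, y ∈ E(K̄_v)` be fixed by `H_∞` with `p x = g y − y`. Then there is a continuous
`1`-cocycle `c` of `H_n` with values in `E(K̄_v)` vanishing on `H_∞`, with `c(g) = x` and `p c(σ) = σ y − y` for every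
`σ ∈ H_n`, such that `r (c σ) = 0` for every `σ ∈ H_{n+1}` and every additive map `r` with `r (g • Q) = r Q`
(on the coset `g^i H_{n+R}` the value is `S_i(x) = Σ_{j<i} g^j x`, `r(S_i(x)) = i · r x`, `σ ∈ H_{n+1} ⟺ p ∣ i`, and
`p · r x = r(g y − y) = 0`). Construction: BRICK G2 (`exists_contOneCocycles_inflate`) verbatim at a finite level
`n + R₀` fixing `x, y` with `R₀ ≥ 1`: `S_{p^{R₀+1}}(x) = p S_{p^{R₀}}(x) = 0` because `p S_{p^{R₀}}(x) = g^{p^{R₀}} y − y = 0`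
puts `S_{p^{R₀}}(x)` in `E[p]`, which is fixed by `g^{p^{R₀}} = (g^{p^{R₀−1}})^p`.
[cite: GreenbergLNM1716, §3 Lemma 3.1 (p. 86)] [cite: SerreLocalFields1979, XIII §1 Prop. 1] -/
theorem exists_contOneCocycles_inflate_of_pow_smul (hκ : κ.IsCyclotomic) (v : HeightOneSpectrum (𝓞 ℚ))
    (hv : ((p : ℕ) : 𝓞 ℚ) ∈ v.asIdeal) (W : WeierstrassCurve ℚ) (n : ℕ)
    {g : absoluteGaloisGroup (v.adicCompletion ℚ)}
    (hg : g ∈ localSubgroup (κ.layerSubgroup n) (v.adicCompletion ℚ))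
    (hgen : ∀ U : Subgroup (absoluteGaloisGroup (v.adicCompletion ℚ)),
      IsOpen (U : Set (absoluteGaloisGroup (v.adicCompletion ℚ))) →
        localSubgroup κ.kerSubgroup (v.adicCompletion ℚ) ≤ U → g ∈ U →
          localSubgroup (κ.layerSubgroup n) (v.adicCompletion ℚ) ≤ U)
    (hZp : ∀ a : localPoints W (v.adicCompletion ℚ), p • a = 0 →
      ∀ σ : absoluteGaloisGroup (v.adicCompletion ℚ), (σ ^ p) • a = a)
    {T : Type*} [AddCommGroup T] (r : localPoints W (v.adicCompletion ℚ) →+ T)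
    (hr : ∀ Q : localPoints W (v.adicCompletion ℚ), r (g • Q) = r Q)
    {x y : localPoints W (v.adicCompletion ℚ)}
    (hxi : ∀ h ∈ localSubgroup κ.kerSubgroup (v.adicCompletion ℚ), h • x = x)
    (hyi : ∀ h ∈ localSubgroup κ.kerSubgroup (v.adicCompletion ℚ), h • y = y)
    (hrel : p • x = g • y - y) :
    ∃ c : contOneCocycles (discreteTopRep (localSubgroup (κ.layerSubgroup n) (v.adicCompletion ℚ))
      (localPoints W (v.adicCompletion ℚ))),
      (∀ σ : localSubgroup (κ.layerSubgroup n) (v.adicCompletion ℚ),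
        (σ : absoluteGaloisGroup (v.adicCompletion ℚ)) ∈ localSubgroup κ.kerSubgroup (v.adicCompletion ℚ) →
          c.1 σ = 0) ∧
      c.1 ⟨g, hg⟩ = x ∧
      (∀ σ : localSubgroup (κ.layerSubgroup n) (v.adicCompletion ℚ),
        (σ : absoluteGaloisGroup (v.adicCompletion ℚ)) ∈
            localSubgroup (κ.layerSubgroup (n + 1)) (v.adicCompletion ℚ) → r (c.1 σ) = 0) ∧
      (∀ σ : localSubgroup (κ.layerSubgroup n) (v.adicCompletion ℚ),
        p • c.1 σ = (σ : absoluteGaloisGroup (v.adicCompletion ℚ)) • y - y) := by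
  -- notation (`let`, not `set`: no context rewriting)
  let K := v.adicCompletion ℚ
  let P : Type := localPoints W K
  let Hn : Subgroup (absoluteGaloisGroup K) := localSubgroup (κ.layerSubgroup n) K
  let X : TopRep ℤ Hn := discreteTopRep Hn P
  let γ : Hn := ⟨g, hg⟩
  have hXρ : ∀ (σ : Hn) (m : P), X.ρ σ m = (σ : absoluteGaloisGroup K) • m := fun _ _ ↦ rfl
  have hXρpow : ∀ (j : ℕ) (m : P), X.ρ (γ ^ j) m = (g ^ j) • m := fun j m ↦ by
    rw [hXρ, SubgroupClass.coe_pow]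
  have hp : Nat.Prime p := Fact.out
  -- `κ(res g) = p^n u`
  obtain ⟨u, hu⟩ := MultTowerSP1.exists_units_kappa_resGal_eq_of_generate hκ v hv n hg hgen
  have hgi : ∀ (R i : ℕ), g ^ i ∈ localSubgroup (κ.layerSubgroup (n + R)) K ↔ p ^ R ∣ i := fun R i ↦
    MultTowerSP1.pow_mem_localSubgroup_layerSubgroup_iff (κ := κ) v n R hu i
  -- a common finite level `n + R₀`, `R₀ ≥ 1`, for `x` and `y`
  obtain ⟨m₁, hm₁⟩ := exists_forall_mem_localSubgroup_layerSubgroup_smul_point_eq (κ := κ) v W x hxi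
  obtain ⟨m₂, hm₂⟩ := exists_forall_mem_localSubgroup_layerSubgroup_smul_point_eq (κ := κ) v W y hyi
  obtain ⟨R₀, hR₀, hxR₀, hyR₀⟩ : ∃ R₀ : ℕ, 1 ≤ R₀ ∧ (∀ h ∈ localSubgroup (κ.layerSubgroup (n + R₀)) K, h • x = x) ∧
      ∀ h ∈ localSubgroup (κ.layerSubgroup (n + R₀)) K, h • y = y :=
    ⟨max m₁ m₂ + 1, by omega,
      fun h hh ↦ hm₁ h (MultTowerSP1.localSubgroup_layerSubgroup_antitone κ K
        (show m₁ ≤ n + (max m₁ m₂ + 1) by omega) hh),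
      fun h hh ↦ hm₂ h (MultTowerSP1.localSubgroup_layerSubgroup_antitone κ K
        (show m₂ ≤ n + (max m₁ m₂ + 1) by omega) hh)⟩
  have hleR : localSubgroup (κ.layerSubgroup (n + (R₀ + 1))) K ≤ localSubgroup (κ.layerSubgroup (n + R₀)) K :=
    MultTowerSP1.localSubgroup_layerSubgroup_antitone κ K (by omega)
  have hxR : ∀ h ∈ localSubgroup (κ.layerSubgroup (n + (R₀ + 1))) K, h • x = x := fun h hh ↦ hxR₀ h (hleR hh)
  have hyR : ∀ h ∈ localSubgroup (κ.layerSubgroup (n + (R₀ + 1))) K, h • y = y := fun h hh ↦ hyR₀ h (hleR hh)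
  -- the open normal subgroup `H = H_{n+R₀+1} ∩ H_n` of `H_n` and the cyclic quotient `H_n / H = ⟨ḡ⟩`
  have hnormal : (localSubgroup (κ.layerSubgroup (n + (R₀ + 1))) K).Normal := by
    rw [localSubgroup_eq_comap]; exact Subgroup.Normal.comap inferInstance _
  let H : Subgroup Hn := (localSubgroup (κ.layerSubgroup (n + (R₀ + 1))) K).subgroupOf Hn
  haveI hHnormal : H.Normal := Subgroup.normal_subgroupOf
  have hmemH : ∀ σ : Hn, σ ∈ H ↔
      (σ : absoluteGaloisGroup K) ∈ localSubgroup (κ.layerSubgroup (n + (R₀ + 1))) K :=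
    fun σ ↦ Subgroup.mem_subgroupOf
  have hHopen : IsOpen (H : Set Hn) :=
    (MultTowerNS2.isOpen_localSubgroup _ (κ.isOpen_layerSubgroup (n + (R₀ + 1))) K).preimage
      continuous_subtype_val
  have hgenQ : ∀ q : Hn ⧸ H, ∃ i : ℕ, q = (QuotientGroup.mk γ : Hn ⧸ H) ^ i := by
    intro q
    obtain ⟨σ, rfl⟩ := QuotientGroup.mk_surjective q
    obtain ⟨i, -, hi⟩ := exists_pow_inv_mul_mem_localSubgroup_layerSubgroup (κ := κ) v n (R₀ + 1) hu σ.2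
    refine ⟨i, ?_⟩
    rw [← QuotientGroup.mk_pow, eq_comm, QuotientGroup.eq, hmemH]
    simpa only [Subgroup.coe_mul, Subgroup.coe_inv, SubgroupClass.coe_pow] using hi
  -- the order of `ḡ` is `p^(R₀+1)`
  have hord : orderOf (QuotientGroup.mk γ : Hn ⧸ H) = p ^ (R₀ + 1) := by
    have key : ∀ i : ℕ, (QuotientGroup.mk γ : Hn ⧸ H) ^ i = 1 ↔ p ^ (R₀ + 1) ∣ i := fun i ↦ by
      rw [← QuotientGroup.mk_pow, QuotientGroup.eq_one_iff, hmemH, SubgroupClass.coe_pow]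
      exact hgi (R₀ + 1) i
    exact Nat.dvd_antisymm (orderOf_dvd_of_pow_eq_one ((key _).mpr dvd_rfl)) ((key _).mp (pow_orderOf_eq_one _))
  -- the norm vanishes: `S_{p^(R₀+1)}(x) = 0`
  have hN : geomSum (X := X) γ x (orderOf (QuotientGroup.mk γ : Hn ⧸ H)) = 0 := by
    rw [hord]
    -- `p • S_{p^{R₀}}(x) = g^{p^{R₀}} y - y = 0`
    have hgR₀ : g ^ p ^ R₀ ∈ localSubgroup (κ.layerSubgroup (n + R₀)) K := (hgi R₀ _).mpr dvd_rfl
    have hpS : p • geomSum (X := X) γ x (p ^ R₀) = 0 := by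
      rw [← geomSum_nsmul (X := X), hrel, ← hXρ γ y, geomSum_smul_sub_eq (X := X), hXρpow, hyR₀ _ hgR₀,
        sub_self]
    -- hence `S_{p^{R₀}}(x) ∈ E[p]` is fixed by `g^{p^{R₀}} = (g^{p^{R₀-1}})^p`, and `S_{p^{R₀+1}}(x) = p • S_{p^{R₀}}(x)`
    have hpow : g ^ p ^ R₀ = (g ^ p ^ (R₀ - 1)) ^ p := by
      rw [← pow_mul, ← pow_succ, Nat.sub_add_cancel hR₀]
    have hfix : X.ρ (γ ^ p ^ R₀) (geomSum (X := X) γ x (p ^ R₀)) = geomSum (X := X) γ x (p ^ R₀) := by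
      rw [hXρpow, hpow]; exact hZp _ hpS _
    rw [pow_succ, geomSum_mul_eq_nsmul_of_apply_eq (X := X) γ x hfix p, hpS]
  -- translates of `x` are fixed by `H_{n+R₀+1}` (normality), hence so are the sums `S_i(x)`
  have hfixS : ∀ h ∈ localSubgroup (κ.layerSubgroup (n + (R₀ + 1))) K,
      ∀ i : ℕ, h • geomSum (X := X) γ x i = geomSum (X := X) γ x i := by
    intro h hh i
    induction i with
    | zero => rw [geomSum_zero, smul_zero]
    | succ i ih =>
      rw [geomSum_succ, smul_add, ih, hXρpow]
      congr 1
      have hconj : (g ^ i)⁻¹ * h * (g ^ i) ∈ localSubgroup (κ.layerSubgroup (n + (R₀ + 1))) K := by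
        have := hnormal.conj_mem h hh (g ^ i)⁻¹
        rwa [inv_inv] at this
      calc h • (g ^ i) • x = (g ^ i) • (((g ^ i)⁻¹ * h * g ^ i) • x) := by
            rw [← mul_smul, ← mul_smul]; congr 1; group
        _ = (g ^ i) • x := by rw [hxR _ hconj]
  -- the cocycle `σ = g^i h ↦ S_i(x)`
  let f : Hn → P := fun σ ↦ geomSum (X := X) γ x (idxQ H γ hgenQ (σ : Hn ⧸ H))
  have hf_cont : Continuous f := by
    haveI : DiscreteTopology (Hn ⧸ H) := QuotientGroup.discreteTopology hHopen
    have hc : Continuous (fun q : Hn ⧸ H ↦ geomSum (X := X) γ x (idxQ H γ hgenQ q)) :=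
      continuous_of_discreteTopology
    exact hc.comp QuotientGroup.continuous_mk
  -- `σ = g^{idx σ} · h` with `h ∈ H_{n+R₀+1}`
  have hdec : ∀ σ : Hn, ((g ^ idxQ H γ hgenQ (σ : Hn ⧸ H))⁻¹ * (σ : absoluteGaloisGroup K)) ∈
      localSubgroup (κ.layerSubgroup (n + (R₀ + 1))) K := fun σ ↦ by
    have hh := pow_idxQ_inv_mul_mem H γ hgenQ σ
    rw [hmemH] at hh
    simpa only [Subgroup.coe_mul, Subgroup.coe_inv, SubgroupClass.coe_pow] using hh
  have hsplit : ∀ (σ : Hn) (m : P), (σ : absoluteGaloisGroup K) • m =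
      (g ^ idxQ H γ hgenQ (σ : Hn ⧸ H)) • ((g ^ idxQ H γ hgenQ (σ : Hn ⧸ H))⁻¹ * (σ : absoluteGaloisGroup K)) • m :=
    fun σ m ↦ by rw [← mul_smul, mul_inv_cancel_left]
  let c : contOneCocycles X := ⟨⟨f, hf_cont⟩, fun σ τ ↦ by
    change geomSum (X := X) γ x (idxQ H γ hgenQ ((σ * τ : Hn) : Hn ⧸ H)) =
      geomSum (X := X) γ x (idxQ H γ hgenQ (σ : Hn ⧸ H)) +
        X.ρ σ (geomSum (X := X) γ x (idxQ H γ hgenQ (τ : Hn ⧸ H)))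
    rw [geomSum_eq_of_modEq (X := X) γ x hN (idxQ_mul_modEq H γ hgenQ σ τ), geomSum_add, hXρ σ, hsplit σ,
      hfixS _ (hdec σ), hXρpow]⟩
  have hc_apply : ∀ σ : Hn, c.1 σ = geomSum (X := X) γ x (idxQ H γ hgenQ (σ : Hn ⧸ H)) := fun _ ↦ rfl
  -- the parity profile: `r (S_i(x)) = i • r x`, and `p • r x = 0`
  have hrpow : ∀ (j : ℕ) (Q : P), r ((g ^ j) • Q) = r Q := fun j Q ↦ by
    induction j with
    | zero => rw [pow_zero, one_smul]
    | succ j ih => rw [pow_succ', mul_smul, hr, ih]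
  have hrS : ∀ i : ℕ, r (geomSum (X := X) γ x i) = i • r x := fun i ↦ by
    induction i with
    | zero => rw [geomSum_zero, map_zero, zero_nsmul]
    | succ i ih => rw [geomSum_succ, map_add, ih, hXρpow, hrpow, succ_nsmul]
  have hprx : p • r x = 0 := by
    rw [← map_nsmul, hrel, map_sub, hr, sub_self]
  refine ⟨c, fun σ hσ ↦ ?_, ?_, fun σ hσ ↦ ?_, fun σ ↦ ?_⟩
  · -- vanishing on `H_∞ ⊆ H_{n+R₀+1}`: `idx σ ≡ 0`
    rw [hc_apply]
    have hσH : σ ∈ H := by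
      rw [hmemH, mem_localSubgroup_iff]
      exact κ.kerSubgroup_le_layerSubgroup (n + (R₀ + 1)) ((mem_localSubgroup_iff _ _ _).mp hσ)
    have h1 : (σ : Hn ⧸ H) = 1 := (QuotientGroup.eq_one_iff σ).mpr hσH
    have h0 : idxQ H γ hgenQ (σ : Hn ⧸ H) ≡ 0 [MOD orderOf (QuotientGroup.mk γ : Hn ⧸ H)] := by
      rw [← pow_eq_pow_iff_modEq, pow_zero, ← idxQ_spec H γ hgenQ (σ : Hn ⧸ H), h1]
    rw [geomSum_eq_of_modEq (X := X) γ x hN h0, geomSum_zero]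
  · -- `c(g) = S_1(x) = x`
    rw [hc_apply]
    have h1 : idxQ H γ hgenQ (γ : Hn ⧸ H) ≡ 1 [MOD orderOf (QuotientGroup.mk γ : Hn ⧸ H)] := by
      rw [← pow_eq_pow_iff_modEq, pow_one]
      exact (idxQ_spec H γ hgenQ (γ : Hn ⧸ H)).symm
    rw [geomSum_eq_of_modEq (X := X) γ x hN h1, geomSum_one]
  · -- on `H_{n+1}`: `g^i = σ · (h)⁻¹ ∈ H_{n+1}`, so `p ∣ i` and `r(S_i(x)) = i • r x = (i/p) • (p • r x) = 0`
    rw [hc_apply, hrS]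
    set i : ℕ := idxQ H γ hgenQ (σ : Hn ⧸ H) with hi_def
    have hle1 : localSubgroup (κ.layerSubgroup (n + (R₀ + 1))) K ≤ localSubgroup (κ.layerSubgroup (n + 1)) K :=
      MultTowerSP1.localSubgroup_layerSubgroup_antitone κ K (by omega)
    have hgi1 : g ^ i ∈ localSubgroup (κ.layerSubgroup (n + 1)) K := by
      have hh : ((g ^ i)⁻¹ * (σ : absoluteGaloisGroup K)) ∈ localSubgroup (κ.layerSubgroup (n + 1)) K :=
        hle1 (hdec σ)
      have heq : g ^ i = (σ : absoluteGaloisGroup K) * ((g ^ i)⁻¹ * (σ : absoluteGaloisGroup K))⁻¹ := by group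
      rw [heq]
      exact mul_mem hσ (inv_mem hh)
    obtain ⟨j, hj⟩ := (hgi 1 i).mp hgi1
    rw [hj, pow_one, mul_comm, mul_nsmul', hprx, nsmul_zero]
  · -- `p • S_i(x) = S_i(g y - y) = g^i y - y = σ y - y`
    rw [hc_apply, ← geomSum_nsmul (X := X), hrel, ← hXρ γ y, geomSum_smul_sub_eq (X := X), hXρpow,
      hsplit σ y, hyR _ (hdec σ)]

end Summit.BirchSwinnertonDyer.BirchSwinnertonDyer.Theorems.GoodOrdTower

end
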